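import Summits.CriticalPhenomena.Ising3DConformalLimit.Theorems.AnomalousForcesInteractionGaussianLimitIsFreeGaussMarkovRigidity
import Literature.MathematicalPhysics.QuantumLattice.GermMarkovSpectralCriterion
import HarnessLib

/-!
# Crux `GaussianLimitIsFree` (item stmt-CriticalPhenomena-2601), line `registered` (birth v5):
# stub 3 conditional on the CORRECTED spectral criterion (Rozanov's collar form (R))

THEOREM-ONLY file (lead c2).  The Literature file `GermMarkovSpectralCriterion.lean` records
(Erratum in its module docstring) that the first vendored form of Rozanov's criterion,
`InvSpectralDensityPolynomialOfGermMarkov` (germ form (K) at balls), is mis-stated: `φ = 1 + ‖ξ‖²` satisfies its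
hypotheses while `1/φ` is not a polynomial; Rozanov's theorem is about his collar form (R)
(`IsCollarMarkovAt`: the σ-algebra of every small open collar of `∂B` splits the field in `B` and the field in
`(closure B)ᶜ`).  Accordingly the conditional stub-3 theorem `stub_gaussMarkovRigidity_of_spectralCriterion`
(Theorems/…GaussMarkovRigidity.lean) is vacuous, and this file re-lands the same argument conditionally on the
CORRECTED fact:

* the corrected named fact is `Literature.MathematicalPhysics.QuantumLattice.InvSpectralDensityPolynomialOfCollarMarkov`
  (Rozanov 1982, Ch. 3 §2.3 Theorem with Ch. 2 §3.5 Theorem; necessity half; system of open balls; collar form),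
  appended to `GermMarkovSpectralCriterion.lean` next to the erratum;
* `stub_gaussMarkovRigidity_of_collarCriterion` — for `A > 0`, `1/2 ≤ Δ ≤ 1` and a centred Gaussian probability law
  on `𝒮'(ℝ³)` which is collar-Markov at every open ball and has moment densities `(√A)ⁿ·W_Δ`, `Δ = 1/2`; the proof is
  that of `stub_gaussMarkovRigidity_of_spectralCriterion` verbatim (spectral density `A·c·‖ξ‖^{2Δ−3}` by the proved
  Riesz pairing `rieszKernel_fourier_pairing`, Rozanov ⟹ `‖ξ‖^{3−2Δ}` polynomial ⟹ `Δ = 1/2` by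
  `eq_two_of_eval_eq_mul_abs_rpow`), with the Markov hypothesis in collar form.

The registered stub 3 of the skeleton (germ form (K) at balls) then follows from this theorem and the separately
registered Gaussian lemma "(K) at balls ⟹ (R) at balls for laws with locally `L²`-bounded covariance"
(`stub_germToCollar`, Rozanov Ch. 2 §3.3 (3.14)+(3.15) ⟹ (3.10)).  References: Yu. A. Rozanov, *Markov Random Fields*
(1982); S. Kotani, LNM 330 (1973); L. D. Pitt, ARMA 43 (1971).
-/

noncomputable section

namespace Summit.CriticalPhenomena.Ising3DConformalLimit.Cruxes.GaussianLimitIsFree.Birth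

open MeasureTheory Filter Set FourierTransform
open scoped BigOperators Topology ComplexConjugate
open Literature.MathematicalPhysics.QuantumLattice

/-- **Stub `stub_gaussMarkovRigidity`, conditional form on the CORRECTED criterion** (the registered stub signature
with its Markov hypothesis in Rozanov's collar form (R)): for `A > 0`, `1/2 ≤ Δ ≤ 1` and a centred Gaussian probability
law `μ` on `𝒮'(ℝ³)` which is collar-Markov at every open ball and has moment densities `(√A)ⁿ · W_Δ`, `Δ = 1/2`.  The
translation-invariance and reflection-positivity hypotheses are not used.  Proof: spectral density
`φ = A·c·‖ξ‖^{2Δ−3}` (`twoPoint_eq_of_wickMoments`, `rieszKernel_fourier_pairing`), (2.4)/(2.19) by the integrability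
lemmas of `…GaussMarkovRigidity.lean`, Rozanov's criterion, continuity, and rigidity on a line
(`eq_two_of_eval_eq_mul_abs_rpow`). [cite: Rozanov1982, Ch. 3 §2.3 Theorem (p. 115)] -/
theorem stub_gaussMarkovRigidity_of_collarCriterion :
    Literature.MathematicalPhysics.QuantumLattice.InvSpectralDensityPolynomialOfCollarMarkov → ∀ (Δ A : ℝ) (μ : MeasureTheory.Measure (Literature.MathematicalPhysics.QuantumLattice.FieldConfig (EuclideanSpace ℝ (Fin 3)))), 0 < A → 1 / 2 ≤ Δ → Δ ≤ 1 → MeasureTheory.IsProbabilityMeasure μ → Literature.MathematicalPhysics.QuantumLattice.IsGaussianField μ → (∀ (c : EuclideanSpace ℝ (Fin 3)) (r : ℝ), 0 < r → Literature.MathematicalPhysics.QuantumLattice.IsCollarMarkovAt μ (Metric.ball c r)) → Literature.MathematicalPhysics.QuantumLattice.IsTranslationInvariantLaw μ → (∀ (n : ℕ) (c : Fin n → ℂ) (f : Fin n → SchwartzMap (EuclideanSpace ℝ (Fin 3)) ℝ), (∀ i, tsupport ⇑(f i) ⊆ {x : EuclideanSpace ℝ (Fin 3) | 0 < x 0}) →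 0 ≤ (∑ i, ∑ j, (starRingEnd ℂ) (c i) * c j * Literature.MathematicalPhysics.QuantumLattice.genFunctional μ (f j - Literature.MathematicalPhysics.QuantumLattice.thetaTest 3 (f i))).re ∧ (∑ i, ∑ j, (starRingEnd ℂ) (c i) * c j * Literature.MathematicalPhysics.QuantumLattice.genFunctional μ (f j - Literature.MathematicalPhysics.QuantumLattice.thetaTest 3 (f i))).im = 0) → (∀ (n : ℕ) (f : Fin n → SchwartzMap (EuclideanSpace ℝ (Fin 3)) ℝ), Literature.MathematicalPhysics.QuantumLattice.moment μ n f = ∫ x : Fin n → EuclideanSpace ℝ (Fin 3), (Real.sqrt A ^ n * Summit.CriticalPhenomena.Ising3DConformalLimit.MoebiusLimitExistsOnlyInteraction.wickPower Δ n x) * ∏ i, f i (x i)) → Δ = 1 / 2 := by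
  intro hR Δ A μ hA hΔ1 hΔ2 hPμ hG hM _htr _hRP hmom
  -- Steps 1–2: spectral representation of the two-point function, density `φ = A c ‖ξ‖^{2Δ-3}`
  obtain ⟨c, hc, hFc⟩ :=
    Literature.Analysis.Potential.rieszKernel_fourier_pairing (2 * Δ) (by linarith) (by linarith)
  set φ : (EuclideanSpace ℝ (Fin 3)) → ℝ := fun ξ => A * c * ‖ξ‖ ^ (2 * Δ - 3) with hφ
  have hspec : ∀ u v : SchwartzMap (EuclideanSpace ℝ (Fin 3)) ℝ, twoPoint μ u v =
      (∫ ξ, ((φ ξ : ℝ) : ℂ) * (𝓕 (fun x => ((u x : ℝ) : ℂ)) ξ *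
        conj (𝓕 (fun x => ((v x : ℝ) : ℂ)) ξ))).re := by
    intro u v
    rw [twoPoint_eq_of_wickMoments hA.le (by linarith) (by linarith) hmom u v, hFc u v, ← mul_assoc,
      ← Complex.re_ofReal_mul, ← integral_const_mul]
    congr 1
    refine integral_congr_ae (Filter.Eventually.of_forall fun ξ => ?_)
    simp only [hφ]
    push_cast
    ring
  -- Step 3: the hypotheses of Rozanov's criterion for `φ`
  have hφm : Measurable φ := (measurable_norm.pow_const _).const_mul _
  have hφ0 : ∀ ξ, 0 ≤ φ ξ := fun ξ =>
    mul_nonneg (mul_nonneg hA.le hc.le) (Real.rpow_nonneg (norm_nonneg _) _)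
  have hφpos : ∀ᵐ ξ ∂(volume : Measure (EuclideanSpace ℝ (Fin 3))), 0 < φ ξ := by
    filter_upwards [Measure.ae_ne volume (0 : (EuclideanSpace ℝ (Fin 3)))] with ξ hξ
    exact mul_pos (mul_pos hA hc) (Real.rpow_pos_of_pos (norm_pos_iff.2 hξ) _)
  have hφeven : ∀ ξ, φ (-ξ) = φ ξ := fun ξ => by simp only [hφ, norm_neg]
  have hφinv : ∀ ξ : (EuclideanSpace ℝ (Fin 3)), (φ ξ)⁻¹ = (A * c)⁻¹ * ‖ξ‖ ^ (3 - 2 * Δ) := fun ξ => by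
    simp only [hφ]
    rw [mul_inv, ← Real.rpow_neg (norm_nonneg ξ), neg_sub]
  have h24 : Integrable (fun ξ : (EuclideanSpace ℝ (Fin 3)) => (1 + ‖ξ‖ ^ 2) ^ (-((2 : ℕ) : ℝ)) * φ ξ) := by
    have h := (integrable_bracket_mul_norm_rpow_neg (a := 3 - 2 * Δ) (by linarith)
      (by linarith)).const_mul (A * c)
    refine h.congr (Filter.Eventually.of_forall fun ξ => ?_)
    simp only [hφ]
    rw [show -(3 - 2 * Δ) = 2 * Δ - 3 by ring]
    ring
  have h219 : Integrable (fun ξ : (EuclideanSpace ℝ (Fin 3)) => (1 + ‖ξ‖ ^ 2) ^ (-((3 : ℕ) : ℝ)) * (φ ξ)⁻¹) := by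
    have h := (integrable_bracket_mul_norm_rpow (s := 3 - 2 * Δ) (by linarith)
      (by linarith)).const_mul (A * c)⁻¹
    refine h.congr (Filter.Eventually.of_forall fun ξ => ?_)
    beta_reduce
    rw [hφinv]
    ring
  -- Step 3: Rozanov's criterion gives a polynomial `P` with `1/φ = P` a.e.
  obtain ⟨P, hPae⟩ := hR 3 μ φ hPμ hG hφm hφ0 hφpos hφeven ⟨2, h24⟩ ⟨3, h219⟩ hspec hM
  -- Step 4: `(A c)⁻¹ ‖ξ‖^{3-2Δ} = P(ξ)` everywhere, by continuity
  have hgc : Continuous fun ξ : (EuclideanSpace ℝ (Fin 3)) => (A * c)⁻¹ * ‖ξ‖ ^ (3 - 2 * Δ) :=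
    continuous_const.mul (continuous_norm.rpow_const fun _ => Or.inr (by linarith))
  have hPc : Continuous fun ξ : (EuclideanSpace ℝ (Fin 3)) => MvPolynomial.eval (fun i => ξ i) P :=
    (MvPolynomial.continuous_eval P).comp (PiLp.continuous_ofLp 2 (fun _ : Fin 3 => ℝ))
  have hae : (fun ξ : (EuclideanSpace ℝ (Fin 3)) => (A * c)⁻¹ * ‖ξ‖ ^ (3 - 2 * Δ)) =ᵐ[volume]
      fun ξ : (EuclideanSpace ℝ (Fin 3)) => MvPolynomial.eval (fun i => ξ i) P := by
    filter_upwards [hPae] with ξ hξ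
    rw [← hφinv, hξ]
  have heq := (Continuous.ae_eq_iff_eq volume hgc hPc).1 hae
  -- restriction to the first coordinate axis: a one-variable polynomial `q` with `q(t) = K|t|^m`
  set s : Fin 3 → Polynomial ℝ := fun i => if i = 0 then Polynomial.X else 0 with hs
  have hqeval : ∀ t : ℝ, (MvPolynomial.aeval s P).eval t = (A * c)⁻¹ * |t| ^ (3 - 2 * Δ) := by
    intro t
    have h1 : (MvPolynomial.aeval s P).eval t =
        MvPolynomial.eval (fun i => (EuclideanSpace.single (0 : Fin 3) t : (EuclideanSpace ℝ (Fin 3))) i) P := by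
      rw [← Polynomial.coe_aeval_eq_eval, MvPolynomial.comp_aeval_apply, MvPolynomial.aeval_eq_eval]
      have hfg : (fun i => Polynomial.aeval t (s i)) =
          fun i => (EuclideanSpace.single (0 : Fin 3) t : (EuclideanSpace ℝ (Fin 3))) i := by
        funext i
        by_cases hi : i = 0
        · subst hi
          simp [hs]
        · simp [hs, hi]
      rw [hfg]
    have h3 := congrFun heq (EuclideanSpace.single (0 : Fin 3) t)
    simp only [PiLp.norm_single, Real.norm_eq_abs] at h3
    rw [h1, ← h3]
  -- Step 4: rigidity on the line
  have hm := eq_two_of_eval_eq_mul_abs_rpow (inv_pos.2 (mul_pos hA hc)) (by linarith) (by linarith)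
    (MvPolynomial.aeval s P) hqeval
  linarith


end Summit.CriticalPhenomena.Ising3DConformalLimit.Cruxes.GaussianLimitIsFree.Birth

end
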